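import Literature.MathematicalPhysics.KineticTheory.LambertianRedrawNondegenerate
import Literature.Analysis.FluidPDE.HardSphereFlowConstruction
import HarnessLib

/-!
# One-step expected-moment ledger of the Lambertian hard-sphere dynamics

Helper file (`--supports`) of the crux `LambertianEuler` of route `LambertianContactSwap`
(`AtomisticToContinuum/HydrodynamicLimit`, stmt-AtomisticToContinuum-11854), line `Sketch`, stub
`stub_tailsLambda : LambertPairPovzner → TailsLambda` (card `cosine-povzner-ladder`, step T2).

Bobylev's Gaussian-moment ladder for the Lambertian gas `Λ` (free flight to Alexander's exit time,
then the colliding pair's relative velocity redrawn along `lambertDir ω ξ`, `ξ` standard Gaussian: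
`lambertStep`, `lambertStateAfter` of `Literature.MathematicalPhysics.KineticTheory.LambertianHardSphereFlow`)
is run collision by collision. Its first line is the **expected-moment ledger**: the `2k`-th
velocity moment `M_{2k}(z) = ∑ᵢ ‖vᵢ‖^{2k}` changes, in conditional expectation over the fresh noise
of one collision, by `gain − loss` at the colliding pair only, and the geometry-uniform pair Povzner
bound of the cosine redraw (`LambertPairPovzner`, hypothesis `hPP` here, being proved elsewhere on
the line) caps the gain by `(4/(k+1)) (‖vᵢ‖² + ‖vⱼ‖²)^k`.

* `momentLedger_oneStep` — the ONE-STEP LEDGER (main theorem, term-style statement: every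
  hypothesis, `hPP` included, is a `∀`/`→` of the type): for a datum `z` with finite exit time
  whose exit configuration has exactly one incoming contact pair `p = (i, j)` (diameter `ε ≠ 0`),
  `E_ξ[M_{2k}(lambertStep ξ z)] ≤ M_{2k}(z) + (4/(k+1)) (‖vᵢ‖² + ‖vⱼ‖²)^k − ‖vᵢ‖^{2k} − ‖vⱼ‖^{2k}`.

Proof: `lambertStep_eq_lambertPair` identifies the step with the redraw of `p` at the exit
configuration `z' = S_{τ(z)} z` (same velocities as `z`); the sum over particles splits into the
pair `{i, j}` and the rest (unchanged, `lambertPair_apply_of_ne`); the pair term is a bounded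
measurable function of `ξ` (`‖c ± r n‖ ≤ ‖c‖ + |r|`, `‖n‖ ≤ 1`), hence integrable on the
probability space `stdGaussian V3`, and is bounded in the mean by `hPP` at `z'`
(`sepVec_ne_zero_of_mem_contactSet`: a contact pair at diameter `ε ≠ 0` has a nonzero separation
vector).

Not here: the summation of the ledger along the collision sequence under `lambertNoise`, the gain
domination, the loss floor and the moment non-intermittency (card T3–T5: open).
-/

noncomputable section

open MeasureTheory ProbabilityTheory Set Function Filter
open scoped ENNReal InnerProductSpace BigOperators

namespace Summit.AtomisticToContinuum.HydrodynamicLimit.Theorems.LambertianContactSwapLambertianEulerMomentLedger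

open Literature.MathematicalPhysics.KineticTheory Literature.Analysis.FluidPDE
  Literature.Analysis.FluidPDE.Alexander

/-- A sum over `Fin N` splits into the two terms at `i ≠ j` and the sum over the rest. [folklore] -/
theorem sum_eq_add_add_sum_erase {M : Type*} [AddCommMonoid M] {N : ℕ} {i j : Fin N} (hij : i ≠ j)
    (f : Fin N → M) : ∑ l, f l = f i + f j + ∑ l ∈ (Finset.univ.erase i).erase j, f l := by
  have hj : j ∈ Finset.univ.erase i := Finset.mem_erase.2 ⟨hij.symm, Finset.mem_univ j⟩
  rw [← Finset.add_sum_erase _ _ (Finset.mem_univ i), ← Finset.add_sum_erase _ _ hj, add_assoc]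

/-- The Lambertian redraw of the pair `(i, j)` is measurable in the noise `ξ` alone, for ANY
geometry (positions and incoming velocities are constants; only `lambertDir ω ·` varies).
[folklore] -/
theorem measurable_lambertPair_noise {N : ℕ} (G : Geometry (Fin 3) T3) (i j : Fin N)
    (z : Config N (Fin 3) T3) : Measurable fun ξ : V3 => lambertPair G i j z ξ := by
  have hdir : Measurable fun ξ : V3 => lambertDir (G.sepVec (z i).1 (z j).1) ξ :=
    measurable_const.lambertDir measurable_id
  have hw : Measurable fun ξ : V3 =>
      (‖(z i).2 - (z j).2‖ / 2) • lambertDir (G.sepVec (z i).1 (z j).1) ξ :=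
    measurable_const.fun_smul hdir
  refine measurable_pi_lambda _ fun l => ?_
  by_cases hlj : l = j
  · subst hlj
    simp only [lambertPair_apply_right]
    exact measurable_const.prodMk (measurable_const.sub hw)
  by_cases hli : l = i
  · subst hli
    simp only [lambertPair_apply_left hlj]
    exact measurable_const.prodMk (measurable_const.add hw)
  · simp only [lambertPair_apply_of_ne hli hlj]
    exact measurable_const

/-- The redrawn velocities are bounded uniformly in the noise:
`‖v_l'‖ ≤ ‖c‖ + ‖vᵢ − vⱼ‖/2` for every particle `l` of the pair, since `‖lambertDir‖ ≤ 1`; for the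
other particles the velocity is unchanged. Stated for the pair members. [folklore] -/
theorem norm_vel_lambertPair_le {N : ℕ} (G : Geometry (Fin 3) T3) {i j : Fin N} (hij : i ≠ j)
    (z : Config N (Fin 3) T3) (ξ : V3) {l : Fin N} (hl : l = i ∨ l = j) :
    ‖(lambertPair G i j z ξ l).2‖ ≤ ‖(2 : ℝ)⁻¹ • ((z i).2 + (z j).2)‖ + ‖(z i).2 - (z j).2‖ / 2 := by
  have hw : ‖(‖(z i).2 - (z j).2‖ / 2) • lambertDir (G.sepVec (z i).1 (z j).1) ξ‖ ≤
      ‖(z i).2 - (z j).2‖ / 2 := by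
    rw [norm_smul, Real.norm_of_nonneg (by positivity)]
    exact mul_le_of_le_one_right (by positivity) (norm_lambertDir_le_one _ _)
  rcases hl with rfl | rfl
  · rw [lambertPair_apply_left hij]
    exact (norm_add_le _ _).trans (add_le_add le_rfl hw)
  · rw [lambertPair_apply_right]
    exact (norm_sub_le _ _).trans (add_le_add le_rfl hw)

/-- The pair part of the `2k`-th moment after the redraw,
`ξ ↦ ‖vᵢ'‖^{2k} + ‖vⱼ'‖^{2k}`, is integrable against the standard Gaussian (bounded and
measurable on a probability space). [folklore] -/
theorem integrable_pairMoment_lambertPair {N : ℕ} (G : Geometry (Fin 3) T3) {i j : Fin N}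
    (hij : i ≠ j) (z : Config N (Fin 3) T3) (k : ℕ) :
    Integrable (fun ξ : V3 =>
      ‖(lambertPair G i j z ξ i).2‖ ^ (2 * k) + ‖(lambertPair G i j z ξ j).2‖ ^ (2 * k))
      (stdGaussian V3) := by
  set B : ℝ := ‖(2 : ℝ)⁻¹ • ((z i).2 + (z j).2)‖ + ‖(z i).2 - (z j).2‖ / 2 with hB
  have hB0 : 0 ≤ B := by positivity
  have hmeas : Measurable fun ξ : V3 =>
      ‖(lambertPair G i j z ξ i).2‖ ^ (2 * k) + ‖(lambertPair G i j z ξ j).2‖ ^ (2 * k) := by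
    have hP := measurable_lambertPair_noise G i j z
    exact (((measurable_pi_apply i).comp hP).snd.norm.pow_const _).add
      (((measurable_pi_apply j).comp hP).snd.norm.pow_const _)
  refine Integrable.of_bound hmeas.aestronglyMeasurable (B ^ (2 * k) + B ^ (2 * k))
    (Eventually.of_forall fun ξ => ?_)
  have h1 : ‖(lambertPair G i j z ξ i).2‖ ^ (2 * k) ≤ B ^ (2 * k) :=
    pow_le_pow_left₀ (norm_nonneg _) (norm_vel_lambertPair_le G hij z ξ (Or.inl rfl)) _
  have h2 : ‖(lambertPair G i j z ξ j).2‖ ^ (2 * k) ≤ B ^ (2 * k) :=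
    pow_le_pow_left₀ (norm_nonneg _) (norm_vel_lambertPair_le G hij z ξ (Or.inr rfl)) _
  rw [Real.norm_of_nonneg (by positivity)]
  exact add_le_add h1 h2

/-- **One-step expected-moment ledger of the Lambertian dynamics** (card `cosine-povzner-ladder`,
T2, one collision). Let `hPP` be the geometry-uniform pair Povzner bound of the cosine redraw
(`LambertPairPovzner` of line `Sketch`). For a datum `z` of `N` spheres of diameter `ε ≠ 0` whose
free flight exits the hard-sphere domain (`τ(z) < ∞`) at a configuration with exactly one
incoming contact pair `p = (i, j)`, the `2k`-th velocity moment after one Lambertian step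
satisfies, in expectation over the redraw noise `ξ ∼ stdGaussian`,
`E_ξ[∑_l ‖v_l(lambertStep ξ z)‖^{2k}] ≤ ∑_l ‖v_l‖^{2k} + (4/(k+1)) (‖vᵢ‖² + ‖vⱼ‖²)^k − ‖vᵢ‖^{2k} − ‖vⱼ‖^{2k}`:
only the colliding pair's moments change, and their expected post-collisional value is capped by
the Povzner bound (free flight does not change velocities). Term-style statement (all hypotheses
in the type): `hPP`, then `N`, the geometry `G`, `ε ≠ 0`, `k`, the datum `z` with `τ(z) ≠ ∞`, the
pair `p` with `incomingPairs (S_{τ(z)} z) = {p}`. [folklore] -/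
theorem momentLedger_oneStep :
    ∀ (hPP : ∀ (N : ℕ) (G : Geometry (Fin 3) T3) (i j : Fin N), i ≠ j →
      ∀ z : Config N (Fin 3) T3, G.sepVec (z i).1 (z j).1 ≠ 0 → ∀ k : ℕ,
        ∫ ξ, (‖(lambertPair G i j z ξ i).2‖ ^ (2 * k) + ‖(lambertPair G i j z ξ j).2‖ ^ (2 * k))
            ∂(stdGaussian V3) ≤ 4 / (k + 1) * (‖(z i).2‖ ^ 2 + ‖(z j).2‖ ^ 2) ^ k)
    {N : ℕ} (G : Geometry (Fin 3) T3) {ε : ℝ} (hε : ε ≠ 0) (k : ℕ) {z : Config N (Fin 3) T3}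
    (hτ : freeExitTime G ε z ≠ ⊤) {p : Fin N × Fin N}
    (hp : incomingPairs G ε (freeFlight G (freeExitTime G ε z).toReal z) = {p}),
    ∫ ξ, (∑ i, ‖(lambertStep G ε ξ z i).2‖ ^ (2 * k)) ∂(stdGaussian V3) ≤
      (∑ i, ‖(z i).2‖ ^ (2 * k)) + (4 / (k + 1) * (‖(z p.1).2‖ ^ 2 + ‖(z p.2).2‖ ^ 2) ^ k
        - ‖(z p.1).2‖ ^ (2 * k) - ‖(z p.2).2‖ ^ (2 * k)) := by
  intro hPP N G ε hε k z hτ p hp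
  -- the exit configuration and its incoming pair
  set z' : Config N (Fin 3) T3 := freeFlight G (freeExitTime G ε z).toReal z with hz'
  have hmem : p ∈ incomingPairs G ε z' := by rw [hp]; exact mem_singleton p
  obtain ⟨hlt, hcontact, -⟩ := mem_incomingPairs.1 hmem
  have hij : p.1 ≠ p.2 := ne_of_lt hlt
  have hsep : G.sepVec (z' p.1).1 (z' p.2).1 ≠ 0 := sepVec_ne_zero_of_mem_contactSet hε hcontact
  have hvel : ∀ l, (z' l).2 = (z l).2 := fun l => by rw [hz', freeFlight_apply]
  -- the step is the redraw of `p` at `z'`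
  have hstep : ∀ ξ : V3, lambertStep G ε ξ z = lambertPair G p.1 p.2 z' ξ := fun ξ =>
    lambertStep_eq_lambertPair hτ hp
  -- the rest of the sum is unchanged
  set R : ℝ := ∑ l ∈ (Finset.univ.erase p.1).erase p.2, ‖(z l).2‖ ^ (2 * k) with hR
  have hsplit : ∀ ξ : V3, ∑ l, ‖(lambertStep G ε ξ z l).2‖ ^ (2 * k) =
      (‖(lambertPair G p.1 p.2 z' ξ p.1).2‖ ^ (2 * k) +
        ‖(lambertPair G p.1 p.2 z' ξ p.2).2‖ ^ (2 * k)) + R := by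
    intro ξ
    rw [hstep ξ, sum_eq_add_add_sum_erase hij, hR]
    congr 1
    refine Finset.sum_congr rfl fun l hl => ?_
    simp only [Finset.mem_erase] at hl
    rw [lambertPair_apply_of_ne hl.2.1 hl.1, hvel]
  have hsplit0 : ∑ l, ‖(z l).2‖ ^ (2 * k) = ‖(z p.1).2‖ ^ (2 * k) + ‖(z p.2).2‖ ^ (2 * k) + R := by
    rw [sum_eq_add_add_sum_erase hij, hR]
  -- integrate
  have hint := integrable_pairMoment_lambertPair G hij z' k
  have hP := hPP N G p.1 p.2 hij z' hsep k
  rw [hvel, hvel] at hP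
  simp_rw [hsplit]
  rw [integral_add hint (integrable_const R), integral_const, smul_eq_mul, probReal_univ, one_mul,
    hsplit0]
  linarith

end Summit.AtomisticToContinuum.HydrodynamicLimit.Theorems.LambertianContactSwapLambertianEulerMomentLedger

end
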